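import Literature.MathematicalPhysics.QuantumFieldTheory.Balaban1983to89.Beta.StepJetData
import Literature.MathematicalPhysics.QuantumFieldTheory.Balaban1983to89.Beta.AveragingHessianKernels
import Literature.MathematicalPhysics.QuantumFieldTheory.Balaban1983to89.Beta.InterLevelTransport

/-!
# `Balaban1983to89.Beta.BalabanStepJets` — Bałaban's step jet data at `j = 0`, I: the columns of the flat Wilson Hessian
# `E″(1)`, the multiplier-response coefficients of the Lagrange stencil `S^Λ`, and the `j = 0` FIRST-ORDER STENCIL FAMILY
# `S₀ = cE • wilsonA + cVH • mfNeg vhS + cΛ • S^Λ` (REAL weights) with its three socket lemmas, packaged as a `JetData` — v1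

HONEST FRAMING (page 1).  Discharging `FlowStep.BetaPertH` would make Bałaban's ultraviolet stability UNCONDITIONAL — a real
constructive-QFT result; it is NOT the continuum limit and NOT the Clay problem.  This file discharges nothing of `BetaPertH`.  It
ASSEMBLES, inside the colourless `hessKer` model of `Beta/OneStepKernelFamily`, the first-order background stencil family of the
FIRST renormalisation step from blocks landed by the convention owners — an3's one-bond Wilson vertex (through
`StepJetData.wilsonA`), an1's field–multiplier kernel `AveragingHessianKernels.vhS` and constraint Hessian `hessFF`, and the packed
one-step resolvent `OneStepResolventKernel.KInv` — with REAL WEIGHTS `cE, cVH, cΛ`.  No colour weight, no sign convention between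
the three blocks, no value of `N` and no table entry of B12 is asserted: the weights are parameters until the weight node pins them,
and the identification of `TstepOf L 0 (jsBal0Of …)` with Bałaban's step-`0` vacuum-polarization kernel is the route's IDENTIFICATION
SENTENCE (informal; `Beta/OneStepKernelFamily` §9 and the β-lead's ticks (D-a)–(D-g)), never a Prop.

ABSOLUTE RULE (cell charter, verbatim): «No internally-minted statement may enter as a cited fact. Every hypothesis is either
kernel-proved in this package or a verbatim quotation of a PUBLISHED theorem with page reference. The manuscript(s) under audit
are NOT citable for their own disputed steps — they are the thing under adjudication; programme-internal (2001/route/tribunal)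
claims are never citable.»  Accordingly NO declaration below is a `def … : Prop` carrying a citation and no hypothesis of any
theorem is a located manuscript step: everything is [folklore] — definitions, or proved here from the imports.

THE CHART (β-lead RULING (R25-2); one sentence, binding for this lineage's jet data).  All jets are `B`-derivatives in the PRODUCT
CHART `U = e^{W}·e^{B̃(B)}`, MINIMISER-CENTRED: `B̃(B)` is the constrained minimiser with block field `B`, so the first `W`-jet of the
Lagrangian vanishes identically in `B`, the stencils below are `B̃`-derivatives at the flat point indexed by the fine bond `(κ′, u)`,
and they become `B`-vertices only through the chain rule `vertexOfK` along the `ℋ`-column of the resolvent.  HAAR CLAUSE: in this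
chart the one-loop functional carries no measure (Haar-Jacobian) term, so `JetData` has no slot for one (regression test owed by
an1's node 7b: the `d = 1, L = 2` table).

THE STRIPPING CONVENTION (`Beta/StepJetData` §5, binding).  Every block of a colourless stencil is the coefficient of `ad(t_c)`,
hence the stencil is ANTISYMMETRIC on the packed fibre (`S0_antisymm` below): field block `wilsonA`; field–multiplier blocks =
an1's symmetrically packed `vhS` passed through the adapter `mfNeg` (`(inl, inr) = m`, `(inr, inl) = −mᵀ`); Lagrange block built
from an1's antisymmetric `hessFF`.

WHAT `S₀` IS (located, informal — nothing of this paragraph is asserted in Lean).  At the flat point the first `B̃`-jet of the bordered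
Lagrangian Hessian `𝔄(B̃) = [[E″(e^{B̃}) − Λ(B̃)·Q″(e^{B̃}), Q′(e^{B̃})ᵀ], [Q′(e^{B̃}), 0]]` of the first step (`E` = the Wilson
action, `Q` = the one-step covariant averaging, `Λ` = the constraint multiplier along the minimiser family, `Λ(0) = 0`) has three
pieces: (V-Δ) `∂_{B̃}E″` = the one-bond Wilson vertex → `wilsonA`; (V-H) `∂_{B̃}Q′` = an1's `m_b` → `vhS`; and the LAGRANGE piece
`−Λ′[e_{(κ′,u)}]·Q″(1)` → `InterLevelTransport.SLam L (lamCoeffOf (KInv L) L) (hessFF L)`.  The multiplier response `Λ′` is read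
off the differentiated stationarity equation `E″(1)·ℋ = Q′ᵀ·Λ′ (+ gauge rows)` through the multiplier–field block `ℋ♭` of the packed
resolvent — a left inverse of `Q′ᵀ` on the constraint-tangent directions in the KKT algebra — so that on the fine index the
conversion coefficients are `c = ℋ♭ ∘ E″(1)` (§2: the `(μ, y; κ′, u)` entry of that composite, the fine sum written over the box
containing the support of the `E″(1)`-column); another left inverse changes `c` off the tangent directions only, which `vertexOfK`
does not see.  The relative weights and signs of the three pieces, including the sign conventions of the typed KKT matrix, belong
to the weight pin, not to this file — hence three independent real parameters.

CONTENT.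
* §1 THE `E″(1)`-COLUMNS: `bondDelta`, `elCol κ′ u := curvAdj (curv e_{(κ′,u)})` (`AffineAveraging`'s ordered-pair `curv`, so
  `curvAdj ∘ curv` is twice the textbook `d*d`), `bondDelta_translate`, `elCol_translate`, `abs_curv_bondDelta_le`, `abs_elCol_le`
  (`≤ 16·D`), `elCol_eq_zero` (support: sup-norm-`1` box around `u`).
* §2 THE MULTIPLIER-RESPONSE COEFFICIENTS: `box1`, `mem_box1`, `l1_le_of_mem_box1`, `elCol_eq_zero_of_not_mem_box1`,
  `lamCoeffOf A N μ y κ′ u := Σ_{v ∈ box1} Σ_α A (N•y) (u + v) (inr μ) (inl α) · elCol κ′ u α (u + v)`, `lamCoeffOf_translate`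
  (from `shiftK (−N•t) A = A`), `abs_lamCoeffOf_le` (from `Decays A C δ`: constant `3^{d+1}·(d+1)·16(d+1)·C·e^{(d+1)δ}`, rate `δ`
  from the perturbed bond `u` to the multiplier's fine image `N•y`).
* §3 THE `j = 0` STENCIL: `S0 d L cE cVH cΛ κ′ u := cE • wilsonA d κ′ u + cVH • mfNeg (vhS d L κ′ u) + cΛ • SLam L (lamCoeffOf
  (KInv L) L) (hessFF L) κ′ u`; `locStencil_S0` (SOCKET `loc`: some rate `δ > 0` — half the decay rate of `KInv L` given by
  `decays_KInv`, existential at fixed `L`, no uniformity claimed — from `locStencil_wilsonA`, `locStencil_vhS` + `locStencil_mfNeg`,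
  `locStencil_SLam` + `abs_lamCoeffOf_le` + `biLoc_hessFF`, assembled by `locStencil_add` / `locStencil_smul`); `S0_translate`
  (SOCKET `covS` of `vertexOf_translate` / `blockCovariant_KInv`: `S₀ κ′ (u + L•t) = shiftK (−L•t) (S₀ κ′ u)`, from
  `wilsonA_translate`, `vhS_translate` + `mfNeg_shiftK`, `SLam_translate` + `lamCoeffOf_translate` + `shiftK_KInv` +
  `hessFF_translate`); `S0_antisymm` (the convention; the zero blocks `(inl,inl)`/`(inr,inr)` of an1's `vhS` hold by `rfl`); helper `cwsum_antisymm`.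
* §4 PACKAGING: `locStencil_mono`, `vertexFamily₂_mono`, and `jsBal0Of hL cE cVH cΛ W Cw δw hδw hW : JetData d L` — `S₀` with ANY
  second-order family `W` bi-localised at the coarse bonds (`VertexFamily₂ W L Cw δw`, `0 < δw`), common rate the minimum; `jsBal0Of_S`,
  `jsBal0Of_W`.  So `StepJetData.TstepOf L 0 (jsBal0Of …)` is a typed step-`0` kernel and every socket lemma applies to it by name.
WHAT IS NOT HERE: the step-`0` second-order family itself (an3's (V-V) / `PlaquetteVertex2*` tables, an1's second averaging jets, the
Lagrange second jet — the parameter `W`); the steps `j ≥ 1` (composite jets through the `j`-fold minimiser, `JcRec`); the Ward /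
reflection instances (T0)/(T1)/(hW)/(hR) of the step-`0` kernel (P5′); any weight or sign pin.

All declarations are [folklore]: definitions, or proved here from the imports; zero cited facts; zero `sorry`.
-/

open Finset
open scoped BigOperators
open Literature.MathematicalPhysics.QuantumFieldTheory.Balaban1983to89
open Literature.MathematicalPhysics.QuantumFieldTheory.Balaban1983to89.Beta
open B12Sec2to5 (l1 l1_nonneg)
open ExpKernelCalculus (Decays BiLoc VertexFamily VertexFamily₂ shiftK Zl Zl_nonneg l1_sub_triangle l1_sub_symm)
open OneStepResolventKernel (Fib LocStencil JetData KInv decays_KInv shiftK_KInv biLoc_mono)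
open AffineAveraging (Form1 Form2 unitVec unitVec_apply curv curvAdj)
open AffineReproduction (trans1 trans1_apply curvAdj_curv_trans1)
open StepJetData (wilsonA wBound locStencil_wilsonA wilsonA_translate wilsonA_antisymm mfNeg mfNeg_shiftK locStencil_mfNeg
  mfNeg_antisymm locStencil_add locStencil_smul l1_add_le)
open AveragingHessianKernels (vhS locStencil_vhS vhS_translate vhS_symm hessFF hessFF_antisymm biLoc_hessFF hessFF_translate ell)
open InterLevelTransport (SLam locStencil_SLam SLam_translate cwsum)

noncomputable section

namespace Literature.MathematicalPhysics.QuantumFieldTheory.Balaban1983to89.Beta.BalabanStepJets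

/-! ## §1 The columns of the flat Wilson Hessian `E″(1) = d*d` -/

section ElCol

variable {D : ℕ}

/-- [folklore] The elementary fine 1-form supported at the bond `(κ′, u)`. -/
def bondDelta (κ' : Fin D) (u : Fin D → ℤ) : Form1 D ℝ := fun l z => if l = κ' ∧ z = u then 1 else 0

/-- [folklore] **THE `(κ′, u)`-COLUMN OF THE FLAT WILSON HESSIAN** in the colourless model: `elCol κ′ u α x :=
(curvAdj (curv e_{(κ′,u)}))_α(x)`, the entry `((α, x), (κ′, u))` of the Euler–Lagrange operator `d*d` of `½ Σ |curv A|²`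
(`AffineAveraging.curvAdj ∘ curv`, ordered-pair convention of `curv`). -/
def elCol (κ' : Fin D) (u : Fin D → ℤ) : Form1 D ℝ := curvAdj (curv (bondDelta κ' u))

/-- [folklore] Translating the bond translates the elementary 1-form. -/
theorem bondDelta_translate (κ' : Fin D) (u v : Fin D → ℤ) : bondDelta κ' (u + v) = trans1 (-v) (bondDelta κ' u) := by
  funext l z
  simp only [bondDelta, trans1_apply]
  have h : (z = u + v) ↔ (z + -v = u) := by
    constructor
    · intro e; rw [e]; abel
    · intro e; rw [← e]; abel
  simp only [h]

/-- [folklore] **TRANSLATION COVARIANCE OF THE COLUMNS**: `elCol κ′ (u + v) α (x + v) = elCol κ′ u α x`. -/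
theorem elCol_translate (κ' : Fin D) (u v : Fin D → ℤ) (α : Fin D) (x : Fin D → ℤ) :
    elCol κ' (u + v) α (x + v) = elCol κ' u α x := by
  unfold elCol
  rw [bondDelta_translate, curvAdj_curv_trans1, trans1_apply]
  congr 1; abel

/-- [folklore] Entries of `curv` of an elementary 1-form are bounded by `4`. -/
theorem abs_curv_bondDelta_le (κ' : Fin D) (u : Fin D → ℤ) (κ l : Fin D) (y : Fin D → ℤ) :
    |curv (bondDelta κ' u) κ l y| ≤ 4 := by
  simp only [curv, bondDelta]
  split_ifs <;> norm_num

/-- [folklore] **UNIFORM BOUND ON THE COLUMNS**: `|elCol κ′ u α x| ≤ 16·D`. -/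
theorem abs_elCol_le (κ' : Fin D) (u : Fin D → ℤ) (α : Fin D) (x : Fin D → ℤ) : |elCol κ' u α x| ≤ 16 * (D : ℝ) := by
  unfold elCol curvAdj
  have h8 : ∀ (a b : ℝ), |a| ≤ 4 → |b| ≤ 4 → |a - b| ≤ 8 := fun a b ha hb => by
    calc |a - b| ≤ |a| + |b| := abs_sub _ _
      _ ≤ 8 := by linarith
  have h1 : |∑ l : Fin D, (curv (bondDelta κ' u) α l x - curv (bondDelta κ' u) α l (x - unitVec l))| ≤ 8 * (D : ℝ) := by
    calc _ ≤ ∑ l : Fin D, |curv (bondDelta κ' u) α l x - curv (bondDelta κ' u) α l (x - unitVec l)| := abs_sum_le_sum_abs _ _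
      _ ≤ ∑ _l : Fin D, (8 : ℝ) := sum_le_sum fun l _ => h8 _ _ (abs_curv_bondDelta_le _ _ _ _ _) (abs_curv_bondDelta_le _ _ _ _ _)
      _ = 8 * (D : ℝ) := by simp [mul_comm]
  have h2 : |∑ κ : Fin D, (curv (bondDelta κ' u) κ α (x - unitVec κ) - curv (bondDelta κ' u) κ α x)| ≤ 8 * (D : ℝ) := by
    calc _ ≤ ∑ κ : Fin D, |curv (bondDelta κ' u) κ α (x - unitVec κ) - curv (bondDelta κ' u) κ α x| := abs_sum_le_sum_abs _ _
      _ ≤ ∑ _κ : Fin D, (8 : ℝ) := sum_le_sum fun κ _ => h8 _ _ (abs_curv_bondDelta_le _ _ _ _ _) (abs_curv_bondDelta_le _ _ _ _ _)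
      _ = 8 * (D : ℝ) := by simp [mul_comm]
  calc _ ≤ |∑ l : Fin D, (curv (bondDelta κ' u) α l x - curv (bondDelta κ' u) α l (x - unitVec l))|
        + |∑ κ : Fin D, (curv (bondDelta κ' u) κ α (x - unitVec κ) - curv (bondDelta κ' u) κ α x)| := abs_add_le _ _
    _ ≤ 16 * (D : ℝ) := by linarith

/-- [folklore] **SUPPORT OF THE COLUMNS**: `elCol κ′ u α x = 0` unless `x` lies in the sup-norm-`1` box around `u`. -/
theorem elCol_eq_zero {κ' : Fin D} {u : Fin D → ℤ} {α : Fin D} {x : Fin D → ℤ} (h : ∃ i, 1 < |x i - u i|) : elCol κ' u α x = 0 := by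
  obtain ⟨i, hi⟩ := h
  have hi' : x i - u i < -1 ∨ 1 < x i - u i := by
    rcases lt_abs.mp hi with h | h
    · exact Or.inr h
    · exact Or.inl (by linarith)
  -- every lattice point read by the stencil differs from `x` by at most one unit step in each coordinate, hence is `≠ u`
  have key : ∀ p : Fin D → ℤ, (p i - x i = 0 ∨ p i - x i = 1 ∨ p i - x i = -1) → (p = u ↔ False) := by
    intro p hp
    constructor
    · intro e; rw [e] at hp; omega
    · exact False.elim
  have e1 : ∀ l : Fin D, (unitVec l : Fin D → ℤ) i = if i = l then 1 else 0 := fun l => unitVec_apply l i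
  have k0 : (x = u ↔ False) := key x (by simp)
  have k1 : ∀ l : Fin D, (x + unitVec l = u ↔ False) := fun l => key _ (by
    simp only [Pi.add_apply, e1]; split_ifs <;> simp)
  have k2 : ∀ l : Fin D, (x - unitVec l = u ↔ False) := fun l => key _ (by
    simp only [Pi.sub_apply, e1]; split_ifs <;> simp)
  have k3 : ∀ l m : Fin D, (x - unitVec l + unitVec m = u ↔ False) := fun l m => key _ (by
    simp only [Pi.add_apply, Pi.sub_apply, e1]; split_ifs <;> simp)
  simp only [elCol, curvAdj, curv, bondDelta, k0, k1, k2, k3, and_false, if_false]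
  simp

end ElCol

/-! ## §2 The multiplier-response coefficients `c = (ℋ♭ ∘ E″(1))` of the Lagrange stencil `S^Λ` -/

section LamCoeff

variable {d : ℕ}

/-- [folklore] The sup-norm-`1` box `{−1, 0, 1}^{d+1}` of fine offsets (contains the support of every column `elCol κ′ u · (u + ·)`). -/
def box1 (D : ℕ) : Finset (Fin D → ℤ) := Fintype.piFinset fun _ => ({-1, 0, 1} : Finset ℤ)

/-- [folklore] Membership in the box. -/
theorem mem_box1 {D : ℕ} {v : Fin D → ℤ} : v ∈ box1 D ↔ ∀ i, v i = -1 ∨ v i = 0 ∨ v i = 1 := by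
  simp [box1, Fintype.mem_piFinset]

/-- [folklore] Offsets in the box have `ℓ¹`-norm at most `D`. -/
theorem l1_le_of_mem_box1 {D : ℕ} {v : Fin D → ℤ} (hv : v ∈ box1 D) : l1 v ≤ (D : ℝ) := by
  rw [mem_box1] at hv
  unfold l1
  calc ∑ i, |((v i : ℤ) : ℝ)| ≤ ∑ _i : Fin D, (1 : ℝ) := Finset.sum_le_sum fun i _ => by
          rcases hv i with h | h | h <;> simp [h]
    _ = (D : ℝ) := by simp

/-- [folklore] Outside the box a column entry vanishes: `v ∉ box1 ⇒ elCol κ′ u α (u + v) = 0`. -/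
theorem elCol_eq_zero_of_not_mem_box1 {D : ℕ} {κ' : Fin D} {u v : Fin D → ℤ} {α : Fin D} (hv : v ∉ box1 D) :
    elCol κ' u α (u + v) = 0 := by
  rw [mem_box1] at hv
  simp only [not_forall, not_or] at hv
  obtain ⟨i, h1, h2, h3⟩ := hv
  refine elCol_eq_zero ⟨i, ?_⟩
  simp only [Pi.add_apply, add_sub_cancel_left]
  rcases lt_trichotomy (v i) 0 with h | h | h
  · rw [abs_of_neg h]; omega
  · exact absurd h h2
  · rw [abs_of_pos h]; omega

/-- [folklore] **THE MULTIPLIER-RESPONSE COEFFICIENTS** of the Lagrange stencil for a packed bordered-resolvent kernel `A`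
(blocking `N`): `lamCoeffOf A N μ y κ′ u := Σ_{v ∈ box1} Σ_α A (N•y) (u+v) (inr μ) (inl α) · elCol κ′ u α (u+v)` — the
`((μ, y), (κ′, u))` entry of `ℋ♭ ∘ E″(1)` (multiplier–field block of `A` composed with the flat Wilson Hessian), i.e. the
first-order response `Λ′` of the constraint multiplier to the fine background perturbation `e_{(κ′,u)}` read through the
left inverse `ℋ♭` of `Q′ᵀ` (`ℋ♭ Q′ᵀ = 1` is the `(Λ, Λ)` block of `A·K = 1`); the fine sum is written over the box containing
the support of the column (`elCol_eq_zero_of_not_mem_box1`).  For Bałaban's `j = 0` data `A := KInv (N := L)`. -/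
def lamCoeffOf (A : ExpKernelCalculus.MKer (d + 1) (Fib d)) (N : ℕ) (μ : Fin (d + 1)) (y : Fin (d + 1) → ℤ)
    (κ' : Fin (d + 1)) (u : Fin (d + 1) → ℤ) : ℝ :=
  ∑ v ∈ box1 (d + 1), ∑ α : Fin (d + 1), A ((N : ℤ) • y) (u + v) (Sum.inr μ) (Sum.inl α) * elCol κ' u α (u + v)

/-- [folklore] **BLOCK-TRANSLATION COVARIANCE OF THE COEFFICIENTS**: for a block-translation invariant `A`
(`shiftK (−N•t) A = A`), `lamCoeffOf A N μ (y + t) κ′ (u + N•t) = lamCoeffOf A N μ y κ′ u`. -/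
theorem lamCoeffOf_translate {A : ExpKernelCalculus.MKer (d + 1) (Fib d)} {N : ℕ}
    (hA : ∀ t : Fin (d + 1) → ℤ, shiftK (-((N : ℤ) • t)) A = A) (μ : Fin (d + 1)) (y : Fin (d + 1) → ℤ) (κ' : Fin (d + 1))
    (u t : Fin (d + 1) → ℤ) : lamCoeffOf A N μ (y + t) κ' (u + (N : ℤ) • t) = lamCoeffOf A N μ y κ' u := by
  unfold lamCoeffOf
  refine Finset.sum_congr rfl fun v _ => Finset.sum_congr rfl fun α _ => ?_
  have h1 : elCol κ' (u + (N : ℤ) • t) α (u + (N : ℤ) • t + v) = elCol κ' u α (u + v) := by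
    rw [show u + (N : ℤ) • t + v = (u + v) + (N : ℤ) • t by abel, elCol_translate]
  have h2 : A ((N : ℤ) • (y + t)) (u + (N : ℤ) • t + v) (Sum.inr μ) (Sum.inl α) = A ((N : ℤ) • y) (u + v) (Sum.inr μ) (Sum.inl α) := by
    have e := congrFun (congrFun (hA t) ((N : ℤ) • (y + t))) (u + (N : ℤ) • t + v)
    simp only [shiftK] at e
    rw [← e]
    congr 1
    · rw [smul_add]; abel
    · abel
  rw [h1, h2]

/-- [folklore] **DECAY OF THE COEFFICIENTS** from the perturbed fine bond: `Decays A C δ` gives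
`|lamCoeffOf A N μ y κ′ u| ≤ (3^{d+1}·(d+1)·16(d+1)·C·e^{(d+1)δ}) · e^{−δ·|N•y − u|₁}`. -/
theorem abs_lamCoeffOf_le {A : ExpKernelCalculus.MKer (d + 1) (Fib d)} {N : ℕ} {C δ : ℝ} (hA : Decays A C δ) (hC : 0 ≤ C)
    (hδ : 0 ≤ δ) (μ : Fin (d + 1)) (y : Fin (d + 1) → ℤ) (κ' : Fin (d + 1)) (u : Fin (d + 1) → ℤ) :
    |lamCoeffOf A N μ y κ' u| ≤ ((3 : ℝ) ^ (d + 1) * ((d + 1 : ℕ) : ℝ) * (16 * ((d + 1 : ℕ) : ℝ)) * C *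
      Real.exp (((d + 1 : ℕ) : ℝ) * δ)) * Real.exp (-δ * l1 ((N : ℤ) • y - u)) := by
  unfold lamCoeffOf
  have hterm : ∀ v ∈ box1 (d + 1), ∀ α : Fin (d + 1),
      |A ((N : ℤ) • y) (u + v) (Sum.inr μ) (Sum.inl α) * elCol κ' u α (u + v)| ≤
        C * Real.exp (((d + 1 : ℕ) : ℝ) * δ) * Real.exp (-δ * l1 ((N : ℤ) • y - u)) * (16 * ((d + 1 : ℕ) : ℝ)) := by
    intro v hv α
    rw [abs_mul]
    refine mul_le_mul ?_ (abs_elCol_le κ' u α (u + v)) (abs_nonneg _) (by positivity)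
    have h := hA ((N : ℤ) • y) (u + v) (Sum.inr μ) (Sum.inl α)
    have htri : l1 ((N : ℤ) • y - u) ≤ l1 ((N : ℤ) • y - (u + v)) + l1 v := by
      have := l1_sub_triangle ((N : ℤ) • y) (u + v) u
      rwa [show u + v - u = v by abel] at this
    have hv' : l1 v ≤ ((d + 1 : ℕ) : ℝ) := l1_le_of_mem_box1 hv
    calc |A ((N : ℤ) • y) (u + v) (Sum.inr μ) (Sum.inl α)| ≤ C * Real.exp (-δ * l1 ((N : ℤ) • y - (u + v))) := h
      _ ≤ C * (Real.exp (((d + 1 : ℕ) : ℝ) * δ) * Real.exp (-δ * l1 ((N : ℤ) • y - u))) := by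
          refine mul_le_mul_of_nonneg_left ?_ hC
          rw [← Real.exp_add]
          exact Real.exp_le_exp.mpr (by nlinarith)
      _ = C * Real.exp (((d + 1 : ℕ) : ℝ) * δ) * Real.exp (-δ * l1 ((N : ℤ) • y - u)) := by ring
  have hcard : ((box1 (d + 1)).card : ℝ) = (3 : ℝ) ^ (d + 1) := by
    simp [box1, Fintype.card_piFinset]
  calc |∑ v ∈ box1 (d + 1), ∑ α : Fin (d + 1), A ((N : ℤ) • y) (u + v) (Sum.inr μ) (Sum.inl α) * elCol κ' u α (u + v)|
      ≤ ∑ v ∈ box1 (d + 1), ∑ α : Fin (d + 1), |A ((N : ℤ) • y) (u + v) (Sum.inr μ) (Sum.inl α) * elCol κ' u α (u + v)| :=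
        (abs_sum_le_sum_abs _ _).trans (sum_le_sum fun v _ => abs_sum_le_sum_abs _ _)
    _ ≤ ∑ v ∈ box1 (d + 1), ∑ _α : Fin (d + 1),
          C * Real.exp (((d + 1 : ℕ) : ℝ) * δ) * Real.exp (-δ * l1 ((N : ℤ) • y - u)) * (16 * ((d + 1 : ℕ) : ℝ)) :=
        sum_le_sum fun v hv => sum_le_sum fun α _ => hterm v hv α
    _ = _ := by
        simp only [sum_const, card_univ, Fintype.card_fin, nsmul_eq_mul, hcard]
        push_cast
        ring

end LamCoeff

/-! ## §3 Bałaban's `j = 0` first-order stencil family `S₀` and its socket lemmas -/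

section StepZero

variable (d : ℕ) (Lc : ℕ) [NeZero Lc]

/-- [folklore] **BAŁABAN'S `j = 0` FIRST-ORDER STENCIL FAMILY** (colourless `hessKer` model, product chart, minimiser-centred;
THE STRIPPING CONVENTION of `StepJetData` §5: every block is the `ad(t_c)`-coefficient, antisymmetric on the packed fibre), with
REAL WEIGHTS `cE, cVH, cΛ` (the colour/normalisation numbers are pinned elsewhere, never here):
`S₀ κ′ u := cE • wilsonA κ′ u + cVH • mfNeg (vhS L κ′ u) + cΛ • S^Λ κ′ u`, where (V-Δ) `wilsonA` = the antisymmetrised one-bond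
Wilson vertex (`StepJetData`), (V-H) `vhS` = an1's field–multiplier kernel `m_b` of the one-step averaging in the product chart
(`AveragingHessianKernels`, consumed through the block-sign adapter `mfNeg`), and the Lagrange stencil
`S^Λ = SLam L (lamCoeffOf (KInv L) L) (hessFF L)` (`InterLevelTransport.SLam`: `−Σ_{(μ,y)} Λ′_{(μ,y)}[e_{(κ′,u)}] • Q″_{(μ,y)}(1)`
with an1's constraint Hessian `hessFF` and the multiplier response of §2). -/
def S0 (cE cVH cΛ : ℝ) : Fin (d + 1) → (Fin (d + 1) → ℤ) → ExpKernelCalculus.MKer (d + 1) (Fib d) := fun κ' u =>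
  cE • wilsonA d κ' u + cVH • mfNeg (vhS d Lc κ' u) +
    cΛ • SLam Lc (lamCoeffOf (KInv (N := Lc) (d := d)) Lc) (fun μ y => hessFF Lc μ y) κ' u

variable {d Lc}

/-- [folklore] **`S₀` IS A LOCAL STENCIL FAMILY** (the `loc` field of `JetData`): some rate `δ > 0` and constant `Cs` with
`LocStencil (S₀ …) Cs δ` — from `locStencil_wilsonA`, `locStencil_vhS` + `locStencil_mfNeg`, and `locStencil_SLam` fed with the
decay of the multiplier response (`abs_lamCoeffOf_le` + `decays_KInv`) and an1's `biLoc_hessFF`; the rate is half the decay rate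
of `KInv L` (existential at fixed `L`; no uniformity claimed). -/
theorem locStencil_S0 (hLc : 1 ≤ Lc) (cE cVH cΛ : ℝ) : ∃ Cs δ : ℝ, 0 < δ ∧ LocStencil (S0 d Lc cE cVH cΛ) Cs δ := by
  obtain ⟨δ₀, C, hδ₀, hC, hdec⟩ := decays_KInv (N := Lc) (d := d)
  have hδ2 : (0 : ℝ) ≤ δ₀ / 2 := by positivity
  have h1 : LocStencil (wilsonA d) (wBound d * Real.exp (4 * (δ₀ / 2))) (δ₀ / 2) := locStencil_wilsonA hδ2
  have h2 : LocStencil (fun κ' u => mfNeg (vhS d Lc κ' u))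
      (3 * (ell (d + 1) Lc : ℝ) ^ 2 * Real.exp (4 * ((d : ℝ) + 1) * Lc * (δ₀ / 2))) (δ₀ / 2) :=
    locStencil_mfNeg (locStencil_vhS hLc hδ2)
  have hc := abs_lamCoeffOf_le (N := Lc) hdec hC hδ₀.le
  have hQ : VertexFamily (fun μ y => hessFF (d := d) Lc μ y) Lc
      (2 * (ell (d + 1) Lc : ℝ) ^ 2 * Real.exp (4 * ((d : ℝ) + 1) * Lc * δ₀)) δ₀ := fun μ y => biLoc_hessFF hLc μ y hδ₀.le
  have h3 := locStencil_SLam (N := Lc) hc hQ hδ₀ (mul_nonneg (mul_nonneg (by positivity) hC) (Real.exp_pos _).le)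
  exact ⟨_, δ₀ / 2, by positivity, locStencil_add (locStencil_add (locStencil_smul cE h1) (locStencil_smul cVH h2)) (locStencil_smul cΛ h3)⟩

/-- [folklore] **BLOCK-TRANSLATION COVARIANCE OF `S₀`** (the `covS` hypothesis of `vertexOf_translate` / `blockCovariant_KInv`):
`S₀ κ′ (u + L•t) = shiftK (−L•t) (S₀ κ′ u)` — from `wilsonA_translate` (all fine translations), an1's `vhS_translate` through
`mfNeg_shiftK`, and `SLam_translate` fed with `lamCoeffOf_translate` (`shiftK_KInv`) and `hessFF_translate`. -/
theorem S0_translate (hLc : 1 ≤ Lc) (cE cVH cΛ : ℝ) (κ' : Fin (d + 1)) (u t : Fin (d + 1) → ℤ) :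
    S0 d Lc cE cVH cΛ κ' (u + (Lc : ℤ) • t) = shiftK (-((Lc : ℤ) • t)) (S0 d Lc cE cVH cΛ κ' u) := by
  have h1 := wilsonA_translate (d := d) κ' u ((Lc : ℤ) • t)
  have h2 := vhS_translate (d := d) hLc κ' u t
  have h3 := SLam_translate (N := Lc) (c := lamCoeffOf (KInv (N := Lc) (d := d)) Lc) (Q2 := fun μ y => hessFF (d := d) Lc μ y)
    (fun μ y κ'' u' t' => lamCoeffOf_translate (fun s => shiftK_KInv (N := Lc) (d := d) s) μ y κ'' u' t')
    (fun μ y t' => hessFF_translate μ y t') κ' u t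
  funext x z a b
  simp only [S0, Pi.add_apply, Pi.smul_apply, smul_eq_mul, shiftK]
  rw [h1, h2, mfNeg_shiftK, h3]
  rfl

/-- [folklore] Antisymmetry of a coarse weighted sum of antisymmetric kernels. -/
theorem cwsum_antisymm {N : ℕ} (w : (Fin (d + 1) → ℤ) → ℝ) {K : (Fin (d + 1) → ℤ) → ExpKernelCalculus.MKer (d + 1) (Fib d)}
    (hK : ∀ y x z a b, K y z x b a = -K y x z a b) (x z : Fin (d + 1) → ℤ) (a b : Fib d) :
    cwsum N w K z x b a = -cwsum N w K x z a b := by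
  simp only [cwsum, OneStepResolventKernel.wsum, InterLevelTransport.onLat]
  rw [← tsum_neg]
  refine tsum_congr fun y => ?_
  split_ifs with h
  · rw [hK]; ring
  · simp

/-- [folklore] **`S₀` IS ANTISYMMETRIC ON THE PACKED FIBRE** (THE STRIPPING CONVENTION): `S₀ κ′ u z x b a = −S₀ κ′ u x z a b` —
from `wilsonA_antisymm`, `mfNeg_antisymm` (an1's `vhS_symm` and the packer's zero diagonal blocks) and `hessFF_antisymm`. -/
theorem S0_antisymm (cE cVH cΛ : ℝ) (κ' : Fin (d + 1)) (u x z : Fin (d + 1) → ℤ) (a b : Fib d) :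
    S0 d Lc cE cVH cΛ κ' u z x b a = -S0 d Lc cE cVH cΛ κ' u x z a b := by
  have h1 := wilsonA_antisymm (d := d) κ' u x z a b
  have h2 := mfNeg_antisymm (K := vhS d Lc κ' u) (fun x z a b => vhS_symm Lc κ' u x z a b) (fun _ _ _ _ => rfl)
    (fun _ _ _ _ => rfl) x z a b
  have h3 : SLam Lc (lamCoeffOf (KInv (N := Lc) (d := d)) Lc) (fun μ y => hessFF (d := d) Lc μ y) κ' u z x b a =
      -SLam Lc (lamCoeffOf (KInv (N := Lc) (d := d)) Lc) (fun μ y => hessFF (d := d) Lc μ y) κ' u x z a b := by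
    simp only [SLam, neg_neg]
    rw [← Finset.sum_neg_distrib]
    exact Finset.sum_congr rfl fun μ _ => by
      rw [cwsum_antisymm _ (fun y x z a b => hessFF_antisymm Lc μ y x z a b) x z a b, neg_neg]
  simp only [S0, Pi.add_apply, Pi.smul_apply, smul_eq_mul]
  rw [h1, h2, h3]
  ring

end StepZero

/-! ## §4 Packaging: `S₀` with any admissible second-order family is a `JetData` over the step-`0` system -/

section Packaging

variable {d : ℕ} {Lc : ℕ} [NeZero Lc]

omit [NeZero Lc] in
/-- [folklore] A local stencil family stays local at any smaller rate (constant nonnegative). -/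
theorem locStencil_mono {S : Fin (d + 1) → (Fin (d + 1) → ℤ) → ExpKernelCalculus.MKer (d + 1) (Fib d)} {C δ δ' : ℝ}
    (h : LocStencil S C δ) (hC : 0 ≤ C) (hδ : δ' ≤ δ) : LocStencil S C δ' :=
  fun κ' u => biLoc_mono (h κ' u) hC hδ

omit [NeZero Lc] in
/-- [folklore] A second-order vertex family stays bi-localised at any smaller rate (constant nonnegative). -/
theorem vertexFamily₂_mono {W : Fin (d + 1) → (Fin (d + 1) → ℤ) → Fin (d + 1) → (Fin (d + 1) → ℤ) →
    ExpKernelCalculus.MKer (d + 1) (Fib d)} {N : ℕ} {C δ δ' : ℝ} (h : VertexFamily₂ W N C δ) (hC : 0 ≤ C) (hδ : δ' ≤ δ) :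
    VertexFamily₂ W N C δ' :=
  fun μ y ν y' => biLoc_mono (h μ y ν y') hC hδ

/-- [folklore] **THE `j = 0` JET DATUM WITH FIRST-ORDER PART `S₀`**: for any second-order vertex family `W` bi-localised at the
coarse bonds (rate `δw > 0`; Bałaban's `W` = the (V-V)/second-order tables of an3/an1, abstract here) the pair `(S₀, W)` is a
`JetData d L` (common rate = min of the two; constants chosen from `locStencil_S0`), so `StepJetData.TstepOf L 0 (jsBal0Of …)` is a
typed step-`0` kernel and every socket lemma of `OneStepKernelFamily` / `StepJetData` applies to it BY NAME. -/
def jsBal0Of (hLc : 1 ≤ Lc) (cE cVH cΛ : ℝ)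
    (W : Fin (d + 1) → (Fin (d + 1) → ℤ) → Fin (d + 1) → (Fin (d + 1) → ℤ) → ExpKernelCalculus.MKer (d + 1) (Fib d))
    (Cw δw : ℝ) (hδw : 0 < δw) (hW : VertexFamily₂ W Lc Cw δw) : JetData d Lc :=
  have hS := locStencil_S0 (d := d) (Lc := Lc) hLc cE cVH cΛ
  have hδS : 0 < hS.choose_spec.choose := hS.choose_spec.choose_spec.1
  have hloc : LocStencil (S0 d Lc cE cVH cΛ) hS.choose hS.choose_spec.choose := hS.choose_spec.choose_spec.2
  { S := S0 d Lc cE cVH cΛ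
    W := W
    Cs := hS.choose
    Cw := Cw
    δ := min hS.choose_spec.choose δw
    δ_pos := lt_min hδS hδw
    loc := locStencil_mono hloc ((hloc 0 0).nonneg (Sum.inl 0)) (min_le_left _ _)
    loc₂ := vertexFamily₂_mono hW ((hW 0 0 0 0).nonneg (Sum.inl 0)) (min_le_right _ _) }

/-- [folklore] The first-order part of the packaged datum is `S₀`. -/
@[simp] theorem jsBal0Of_S (hLc : 1 ≤ Lc) (cE cVH cΛ : ℝ)
    (W : Fin (d + 1) → (Fin (d + 1) → ℤ) → Fin (d + 1) → (Fin (d + 1) → ℤ) → ExpKernelCalculus.MKer (d + 1) (Fib d))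
    (Cw δw : ℝ) (hδw : 0 < δw) (hW : VertexFamily₂ W Lc Cw δw) : (jsBal0Of hLc cE cVH cΛ W Cw δw hδw hW).S = S0 d Lc cE cVH cΛ := rfl

/-- [folklore] The second-order part of the packaged datum is the given `W`. -/
@[simp] theorem jsBal0Of_W (hLc : 1 ≤ Lc) (cE cVH cΛ : ℝ)
    (W : Fin (d + 1) → (Fin (d + 1) → ℤ) → Fin (d + 1) → (Fin (d + 1) → ℤ) → ExpKernelCalculus.MKer (d + 1) (Fib d))
    (Cw δw : ℝ) (hδw : 0 < δw) (hW : VertexFamily₂ W Lc Cw δw) : (jsBal0Of hLc cE cVH cΛ W Cw δw hδw hW).W = W := rfl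

end Packaging

end Literature.MathematicalPhysics.QuantumFieldTheory.Balaban1983to89.Beta.BalabanStepJets

end
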